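import Literature.Barriers.CriticalPhenomena.KozmaNitzanDirectedCounterexample
import HarnessLib

/-!
# `NoHeavyLowerTail` (stmt-CriticalPhenomena-4575) — the DIRECTED analogue of the four-point row `Z(3,2)`
# (`OneCutFive.ZeroOneThree`, the glued half of the `|A| = 5` one-cut rung) is FALSE
# (proof-shape constraint: a proof of `Z(3,2)` must use the symmetry of `↔`)

Support / proof-shape file (literature seat `prim-cplus-literature` gen 31; memo
`run/shared/lean/prim/prim-cplus-literature/DIRECTED-ANALOGUES.md` §8 and `gen31-work/Z32-DIRECTED.md`).
Landed `--supports stmt-CriticalPhenomena-4575` by the prover seat `prim-a5-assembly-2` (gen 3) at the literature seat's request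
(prim-a5 INBOX 2026-08-20T02:01Z); kernel-checked there and here.  No named facts, no sorries, no conjectures.

`Z(3,2)` (`Theorems.OneCutFive.ZeroOneThree`, file `…OneCutFiveZeroOne.lean`): for every finite weighted graph,
observer `o`, three vertices `R` with `Σ_{v ∈ R} μ(o ↔ v) > 2` and `t` bounding the three cuts `μ(o ↮ v)`:
`μ{o reaches at most one vertex of R} ≤ t`.  Its DIRECTED analogue (finite digraph: arcs `Fin m`, endpoints
`src tgt`, independent arcs of weights `w`, law `prodBernoulli w`; directed connection `→` =
`DirectedPercolation.openDConn` of `Literature/Barriers/CriticalPhenomena/KozmaNitzanDirectedCounterexample.lean`)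
is FALSE.  Counterexample (the FORWARD-HUB mechanism — not Kozma–Nitzan's back arcs): vertices `o = 0`, a hub
`h = 1`, `R = {a, b, c} = {2, 3, 4}`; arcs `o → h` of weight `3/4`, `o → a`, `o → b`, `o → c` of weight `1/4`,
and weight-one arcs `h → a`, `h → b`, `h → c` (no arc leaves a relay).  Then `μ(o → v) ≥ μ(e_{ov} ∪ {e_{oh}, e_{hv}})
= 13/16` for each `v ∈ R` (so `Σ ≥ 39/16 > 2` and `μ(o ↛ v) ≤ 3/16 =: t`), while on the event
"`e_{oh}` closed and at most one of `e_{oa}, e_{ob}, e_{oc}` open" the observer reaches at most one relay, and this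
event has probability `(1/4)·[(3/4)³ + 3·(1/4)(3/4)²] = 27/128 > 24/128 = t`.  (Closed form with hub arcs of weight
one: `μ{N ≤ 1}/t = (1 − p_a)(1 + 2 p_a) > 1` iff `0 < p_a < 1/2`; the UNDIRECTED twin of this graph satisfies `Z(3,2)`
with equality — the glued-blob tie locus.  With hub arcs of weight `31/32` instead of `1` the directed violation
persists: `889839/4194304 > 105/512`; not formalised here.)

Reading (tool classification only; nothing about the truth of the undirected row): in the digraph, `o` reaching the
relay `a` by its direct arc does not inherit `a`'s blob `{h, a, b, c}`; undirected, `o ↔ a ∧ a ↔ h ⇒ o ↔ h ⇒ o ↔ b, o ↔ c`.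
Hence arguments valid verbatim for single-source ORIENTED reachability (Harris–FKG, BK/Reimer, the single-source
BHK inequalities, the exploration/Markov property of the forward cluster, first-moment counting) cannot prove
`Z(3,2)` on their own.  Companion of `not_directedOneCut` (evidence on the same item; there the mechanism is
Kozma–Nitzan's sure back arcs, which does NOT violate directed `Z(3,2)`).

Only LOWER bounds on connection probabilities are needed (explicit open paths), plus the closure principle
`DirectedPercolation.mem_of_closed` on the three witnessing "closed cylinders".

* `DirectedZeroOneCex.src/tgt/w` — the digraph (7 arcs on `Fin 5`).
* `DirectedZeroOneCex.compl_le` — `μ(o ↛ v) ≤ 3/16` for `v ∈ R`;  `DirectedZeroOneCex.two_lt_sum` — `2 < Σ_v μ(o → v)`.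
* `DirectedZeroOneCex.lowerTail_ge` — `27/128 ≤ μ{o reaches ≤ 1 vertex of R}`.
* `not_directedZeroOneThree` — the negation of the directed analogue of `OneCutFive.ZeroOneThree` (same binders,
  `openDConn src tgt` for `openConn`).
-/

noncomputable section

namespace Summit.CriticalPhenomena.PercolationContinuityZ3.Theorems

open MeasureTheory Set Literature.Probability.LatticeModels
open Literature.Barriers.CriticalPhenomena Literature.Barriers.CriticalPhenomena.DirectedPercolation
open scoped Classical

namespace DirectedZeroOneCex

/-- Tails of the seven arcs (vertices `o = 0`, `h = 1`, `a = 2`, `b = 3`, `c = 4`):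
`e₀ : o → h`, `e₁ : o → a`, `e₂ : o → b`, `e₃ : o → c`, `e₄ : h → a`, `e₅ : h → b`, `e₆ : h → c`. -/
def src : Fin 7 → Fin 5 := ![0, 0, 0, 0, 1, 1, 1]

/-- Heads of the seven arcs. -/
def tgt : Fin 7 → Fin 5 := ![1, 2, 3, 4, 2, 3, 4]

/-- `3/4 ∈ [0,1]` (weight of the hub arc `o → h`). -/
def q34 : unitInterval := ⟨3 / 4, by norm_num, by norm_num⟩

/-- `1/4 ∈ [0,1]` (weight of the direct arcs `o → a`, `o → b`, `o → c`). -/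
def q14 : unitInterval := ⟨1 / 4, by norm_num, by norm_num⟩

/-- Weights: `3/4` on `e₀`; `1/4` on `e₁, e₂, e₃`; `1` on the hub-to-relay arcs `e₄, e₅, e₆`. -/
def w : Fin 7 → unitInterval := ![q34, q14, q14, q14, 1, 1, 1]

/-- The three relays `R = {a, b, c} = {2, 3, 4}`. -/
def relays : Finset (Fin 5) := {2, 3, 4}

/-- The tails of the seven arcs, entrywise. -/
@[simp] private theorem src_vals :
    src 0 = 0 ∧ src 1 = 0 ∧ src 2 = 0 ∧ src 3 = 0 ∧ src 4 = 1 ∧ src 5 = 1 ∧ src 6 = 1 :=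
  ⟨rfl, rfl, rfl, rfl, rfl, rfl, rfl⟩

/-- The heads of the seven arcs, entrywise. -/
@[simp] private theorem tgt_vals :
    tgt 0 = 1 ∧ tgt 1 = 2 ∧ tgt 2 = 3 ∧ tgt 3 = 4 ∧ tgt 4 = 2 ∧ tgt 5 = 3 ∧ tgt 6 = 4 :=
  ⟨rfl, rfl, rfl, rfl, rfl, rfl, rfl⟩

/-- The weights of the seven arcs, entrywise. -/
@[simp] private theorem w_vals :
    (w 0 : ℝ) = 3 / 4 ∧ (w 1 : ℝ) = 1 / 4 ∧ (w 2 : ℝ) = 1 / 4 ∧ (w 3 : ℝ) = 1 / 4 ∧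
      (w 4 : ℝ) = 1 ∧ (w 5 : ℝ) = 1 ∧ (w 6 : ℝ) = 1 :=
  ⟨rfl, rfl, rfl, rfl, rfl, rfl, rfl⟩

/-- There are three relays. -/
theorem relays_card : relays.card = 3 := by decide

local notation "Conn" => openDConn src tgt

/-! #### Cylinder bookkeeping: "all arcs of `F` open" and "all arcs of `F` closed" -/

/-- The cylinder "all arcs of `F` open". -/
def cyl (F : Finset (Fin 7)) : Set (Set (Fin 7)) := {ω | (↑F : Set (Fin 7)) ⊆ ω}

/-- The cylinder "all arcs of `F` closed". -/
def ccyl (F : Finset (Fin 7)) : Set (Set (Fin 7)) := {ω | ∀ i ∈ F, i ∉ ω}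

/-- Mass of the open cylinder on `F`: the product of the weights. -/
private theorem real_cyl (F : Finset (Fin 7)) : (prodBernoulli w).real (cyl F) = ∏ i ∈ F, (w i : ℝ) :=
  prodBernoulli_real_subset w F

/-- Mass of the closed cylinder on `F`: the product of the complementary weights. -/
private theorem real_ccyl (F : Finset (Fin 7)) : (prodBernoulli w).real (ccyl F) = ∏ i ∈ F, (1 - (w i : ℝ)) :=
  prodBernoulli_real_forall_notMem w F

/-- Open cylinders intersect to the open cylinder on the union. -/
private theorem cyl_inter (F G : Finset (Fin 7)) : cyl F ∩ cyl G = cyl (F ∪ G) := by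
  ext ω; simp [cyl, Set.union_subset_iff]

/-- Closed cylinders intersect to the closed cylinder on the union. -/
private theorem ccyl_inter (F G : Finset (Fin 7)) : ccyl F ∩ ccyl G = ccyl (F ∪ G) := by
  ext ω
  simp only [ccyl, mem_inter_iff, mem_setOf_eq, Finset.mem_union]
  constructor
  · rintro ⟨hF, hG⟩ i (hi | hi)
    · exact hF i hi
    · exact hG i hi
  · intro h
    exact ⟨fun i hi => h i (Or.inl hi), fun i hi => h i (Or.inr hi)⟩

/-- Inclusion–exclusion for two open cylinders. -/
private theorem real_cyl_union (F G : Finset (Fin 7)) :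
    (prodBernoulli w).real (cyl F ∪ cyl G) =
      (∏ i ∈ F, (w i : ℝ)) + (∏ i ∈ G, (w i : ℝ)) - ∏ i ∈ F ∪ G, (w i : ℝ) := by
  have h : (prodBernoulli w).real (cyl F ∪ cyl G) + (prodBernoulli w).real (cyl F ∩ cyl G) =
      (prodBernoulli w).real (cyl F) + (prodBernoulli w).real (cyl G) :=
    measureReal_union_add_inter₀ MeasurableSet.of_discrete.nullMeasurableSet
  rw [cyl_inter, real_cyl, real_cyl, real_cyl] at h
  linarith

/-- Inclusion–exclusion for two closed cylinders. -/
private theorem real_ccyl_union (F G : Finset (Fin 7)) :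
    (prodBernoulli w).real (ccyl F ∪ ccyl G) =
      (∏ i ∈ F, (1 - (w i : ℝ))) + (∏ i ∈ G, (1 - (w i : ℝ))) - ∏ i ∈ F ∪ G, (1 - (w i : ℝ)) := by
  have h : (prodBernoulli w).real (ccyl F ∪ ccyl G) + (prodBernoulli w).real (ccyl F ∩ ccyl G) =
      (prodBernoulli w).real (ccyl F) + (prodBernoulli w).real (ccyl G) :=
    measureReal_union_add_inter₀ MeasurableSet.of_discrete.nullMeasurableSet
  rw [ccyl_inter, real_ccyl, real_ccyl, real_ccyl] at h
  linarith

/-- Membership in a one-arc open cylinder. -/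
private theorem mem_cyl_singleton {i : Fin 7} {ω : Set (Fin 7)} : ω ∈ cyl {i} ↔ i ∈ ω := by
  simp [cyl]

/-- Membership in a two-arc open cylinder. -/
private theorem mem_cyl_pair {i j : Fin 7} {ω : Set (Fin 7)} : ω ∈ cyl {i, j} ↔ i ∈ ω ∧ j ∈ ω := by
  simp [cyl, Set.insert_subset_iff]

/-- Membership in a three-arc closed cylinder. -/
private theorem mem_ccyl_triple {i j k : Fin 7} {ω : Set (Fin 7)} :
    ω ∈ ccyl {i, j, k} ↔ i ∉ ω ∧ j ∉ ω ∧ k ∉ ω := by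
  simp [ccyl]

/-! #### Lower bounds on `μ(o → v)`: the direct arc or the two-arc path through the hub -/

/-- `o → v ⊇ {e_{ov}} ∪ {e₀, e_{hv}}` for the relay `v = tgt e_{ov} = tgt e_{hv}`. -/
private theorem sub_conn {d k : Fin 7} (hd : src d = 0) (hk : src k = 1) (hdk : tgt d = tgt k) :
    cyl {d} ∪ cyl {0, k} ⊆ Conn 0 (tgt d) := by
  rintro ω (h | h)
  · have := mem_openDConn_of_mem (src := src) (tgt := tgt) (e := d) (mem_cyl_singleton.1 h)
    rwa [hd] at this
  · obtain ⟨h0, hk'⟩ := mem_cyl_pair.1 h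
    have h1 : ω ∈ Conn 0 (src k) := by
      rw [hk]; exact mem_openDConn_of_mem (src := src) (tgt := tgt) (e := (0 : Fin 7)) h0
    rw [hdk]
    exact mem_openDConn_tail h1 hk'

/-- `μ(o → v) ≥ 13/16` from the direct arc `d` and the two-arc path through the hub (`e₀`, `k`). -/
private theorem real_conn_ge {d k : Fin 7} (hd : src d = 0) (hk : src k = 1) (hdk : tgt d = tgt k)
    (hval : 13 / 16 ≤ (∏ i ∈ ({d} : Finset (Fin 7)), (w i : ℝ)) + (∏ i ∈ ({0, k} : Finset (Fin 7)), (w i : ℝ)) -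
        ∏ i ∈ ({d} ∪ {0, k} : Finset (Fin 7)), (w i : ℝ)) :
    13 / 16 ≤ (prodBernoulli w).real (Conn 0 (tgt d)) := by
  have hm : (prodBernoulli w).real (cyl {d} ∪ cyl {0, k}) ≤ (prodBernoulli w).real (Conn 0 (tgt d)) :=
    measureReal_mono (sub_conn hd hk hdk)
  rw [real_cyl_union] at hm
  exact hval.trans hm

/-- `μ(o → a) ≥ 13/16`. -/
private theorem real_oa_ge : 13 / 16 ≤ (prodBernoulli w).real (Conn 0 2) :=
  real_conn_ge (d := 1) (k := 4) rfl rfl rfl (by simp [Finset.prod_insert, Finset.prod_singleton]; norm_num)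

/-- `μ(o → b) ≥ 13/16`. -/
private theorem real_ob_ge : 13 / 16 ≤ (prodBernoulli w).real (Conn 0 3) :=
  real_conn_ge (d := 2) (k := 5) rfl rfl rfl (by simp [Finset.prod_insert, Finset.prod_singleton]; norm_num)

/-- `μ(o → c) ≥ 13/16`. -/
private theorem real_oc_ge : 13 / 16 ≤ (prodBernoulli w).real (Conn 0 4) :=
  real_conn_ge (d := 3) (k := 6) rfl rfl rfl (by simp [Finset.prod_insert, Finset.prod_singleton]; norm_num)

/-- **Regime hypothesis:** `Σ_{v ∈ R} μ(o → v) ≥ 39/16 > 2`. -/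
theorem two_lt_sum : 2 < ∑ v ∈ relays, (prodBernoulli w).real (Conn 0 v) := by
  rw [show relays = {2, 3, 4} from rfl, Finset.sum_insert (by decide), Finset.sum_insert (by decide),
    Finset.sum_singleton]
  linarith [real_oa_ge, real_ob_ge, real_oc_ge]

/-- **Cut hypothesis at `t = 3/16`:** `μ(o ↛ v) ≤ 3/16` for every relay `v`. -/
theorem compl_le {v : Fin 5} (hv : v ∈ relays) : (prodBernoulli w).real (Conn 0 v)ᶜ ≤ 3 / 16 := by
  have hc : ∀ u : Fin 5, (prodBernoulli w).real (Conn 0 u)ᶜ = 1 - (prodBernoulli w).real (Conn 0 u) := fun u => by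
    rw [measureReal_compl MeasurableSet.of_discrete, probReal_univ]
  simp only [relays, Finset.mem_insert, Finset.mem_singleton] at hv
  rcases hv with rfl | rfl | rfl
  · rw [hc]; linarith [real_oa_ge]
  · rw [hc]; linarith [real_ob_ge]
  · rw [hc]; linarith [real_oc_ge]

/-! #### The three witnessing closed cylinders: the hub arc and two direct arcs closed -/

/-- `E_a = {e₀, e₂, e₃ closed}`: only `a` can be reached. -/
def Ea : Set (Set (Fin 7)) := ccyl {0, 2, 3}
/-- `E_b = {e₀, e₁, e₃ closed}`: only `b` can be reached. -/
def Eb : Set (Set (Fin 7)) := ccyl {0, 1, 3}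
/-- `E_c = {e₀, e₁, e₂ closed}`: only `c` can be reached. -/
def Ec : Set (Set (Fin 7)) := ccyl {0, 1, 2}

/-- Closure principle on `E_a`: every vertex reachable from `o` is `o` or `a`. -/
private theorem reach_Ea {ω : Set (Fin 7)} (hω : ω ∈ Ea) {y : Fin 5} (hy : ω ∈ Conn 0 y) : y = 0 ∨ y = 2 := by
  obtain ⟨h0, h2, h3⟩ := mem_ccyl_triple.1 hω
  have := mem_of_closed (src := src) (tgt := tgt) ({v : Fin 5 | v = 0 ∨ v = 2}) (by simp) ?_ hy
  · simpa using this
  intro e he hsrc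
  fin_cases e <;> simp_all

/-- On `Eb` the observer reaches at most `b`. -/
private theorem reach_Eb {ω : Set (Fin 7)} (hω : ω ∈ Eb) {y : Fin 5} (hy : ω ∈ Conn 0 y) : y = 0 ∨ y = 3 := by
  obtain ⟨h0, h1, h3⟩ := mem_ccyl_triple.1 hω
  have := mem_of_closed (src := src) (tgt := tgt) ({v : Fin 5 | v = 0 ∨ v = 3}) (by simp) ?_ hy
  · simpa using this
  intro e he hsrc
  fin_cases e <;> simp_all

/-- On `Ec` the observer reaches at most `c`. -/
private theorem reach_Ec {ω : Set (Fin 7)} (hω : ω ∈ Ec) {y : Fin 5} (hy : ω ∈ Conn 0 y) : y = 0 ∨ y = 4 := by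
  obtain ⟨h0, h1, h2⟩ := mem_ccyl_triple.1 hω
  have := mem_of_closed (src := src) (tgt := tgt) ({v : Fin 5 | v = 0 ∨ v = 4}) (by simp) ?_ hy
  · simpa using this
  intro e he hsrc
  fin_cases e <;> simp_all

/-- The lower-tail event of `Z(3,2)`: `o` reaches at most one vertex of `R`. -/
def lowerTail : Set (Set (Fin 7)) := {ω | (relays.filter fun v => ω ∈ Conn 0 v).card ≤ 1}

/-- If every vertex reachable from `o` is `o` or the single relay `r`, the filter has at most one element. -/
private theorem card_le_one_of_reach {ω : Set (Fin 7)} {r : Fin 5}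
    (h : ∀ y : Fin 5, ω ∈ Conn 0 y → y = 0 ∨ y = r) : (relays.filter fun v => ω ∈ Conn 0 v).card ≤ 1 := by
  have hsub : (relays.filter fun v => ω ∈ Conn 0 v) ⊆ {r} := by
    intro v hv
    obtain ⟨hvR, hconn⟩ := Finset.mem_filter.1 hv
    rcases h v hconn with h0 | hr
    · subst h0; simp [relays] at hvR
    · exact Finset.mem_singleton.2 hr
  exact (Finset.card_le_card hsub).trans (by simp)

/-- The three witnessing cylinders lie in the lower-tail event. -/
private theorem E_subset : Ea ∪ (Eb ∪ Ec) ⊆ lowerTail := by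
  rintro ω (hω | hω | hω)
  · exact card_le_one_of_reach fun y hy => reach_Ea hω hy
  · exact card_le_one_of_reach fun y hy => reach_Eb hω hy
  · exact card_le_one_of_reach fun y hy => reach_Ec hω hy

/-- `μ(E_b ∪ E_c) = 9/64 + 9/64 − 27/256 = 45/256`. -/
private theorem real_Eb_union_Ec : (prodBernoulli w).real (Eb ∪ Ec) = 45 / 256 := by
  rw [Eb, Ec, real_ccyl_union]
  simp [Finset.prod_insert, Finset.prod_singleton]
  norm_num

/-- `E_a ∩ (E_b ∪ E_c) = {e₀, e₁, e₂, e₃ closed}`. -/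
private theorem Ea_inter : Ea ∩ (Eb ∪ Ec) = ccyl {0, 1, 2, 3} := by
  ext ω
  simp only [Ea, Eb, Ec, ccyl, mem_inter_iff, mem_union, mem_setOf_eq, Finset.mem_insert, Finset.mem_singleton]
  constructor
  · rintro ⟨ha, hb | hc⟩ i hi
    · rcases hi with rfl | rfl | rfl | rfl
      · exact ha 0 (by simp)
      · exact hb 1 (by simp)
      · exact ha 2 (by simp)
      · exact ha 3 (by simp)
    · rcases hi with rfl | rfl | rfl | rfl
      · exact ha 0 (by simp)
      · exact hc 1 (by simp)
      · exact ha 2 (by simp)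
      · exact ha 3 (by simp)
  · intro h
    exact ⟨fun i hi => h i (by rcases hi with rfl | rfl | rfl <;> simp),
      Or.inl fun i hi => h i (by rcases hi with rfl | rfl | rfl <;> simp)⟩

/-- **The lower tail is heavy:** `μ{o reaches ≤ 1 vertex of R} ≥ μ(E_a ∪ E_b ∪ E_c) = 27/128`. -/
theorem lowerTail_ge : 27 / 128 ≤ (prodBernoulli w).real lowerTail := by
  have h : (prodBernoulli w).real (Ea ∪ (Eb ∪ Ec)) + (prodBernoulli w).real (Ea ∩ (Eb ∪ Ec)) =
      (prodBernoulli w).real Ea + (prodBernoulli w).real (Eb ∪ Ec) :=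
    measureReal_union_add_inter₀ MeasurableSet.of_discrete.nullMeasurableSet
  have hEa : (prodBernoulli w).real Ea = 9 / 64 := by
    rw [Ea, real_ccyl]; simp [Finset.prod_insert, Finset.prod_singleton]; norm_num
  have h4 : (prodBernoulli w).real (ccyl {0, 1, 2, 3}) = 27 / 256 := by
    rw [real_ccyl]; simp [Finset.prod_insert, Finset.prod_singleton]; norm_num
  rw [Ea_inter, hEa, h4, real_Eb_union_Ec] at h
  have hu : (prodBernoulli w).real (Ea ∪ (Eb ∪ Ec)) = 27 / 128 := by linarith
  rw [← hu]
  exact measureReal_mono E_subset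

end DirectedZeroOneCex

/-- **The directed analogue of `Z(3,2)` (`OneCutFive.ZeroOneThree`) is false.**  With a finite digraph (`Fin m` arcs
on `Fin n`, endpoints `src, tgt`, independent arcs of weights `w`) and directed connection `openDConn` in place of
`openConn`, the statement "`R.card = 3`, `2 < Σ_{v∈R} μ(o → v)`, `μ(o ↛ v) ≤ t` for `v ∈ R` ⟹
`μ{o reaches ≤ 1 vertex of R} ≤ t`" FAILS: the five-vertex forward-hub digraph above with `t = 3/16` satisfies the
hypotheses but has lower tail `≥ 27/128 = 54/256 > 48/256 = 3/16`. -/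
theorem not_directedZeroOneThree :
    ¬ ∀ (n m : ℕ) (src tgt : Fin m → Fin n) (w : Fin m → unitInterval) (R : Finset (Fin n)) (o : Fin n) (t : ℝ),
        R.card = 3 →
        2 < ∑ v ∈ R, (prodBernoulli w).real (openDConn src tgt o v) →
        (∀ v ∈ R, (prodBernoulli w).real (openDConn src tgt o v)ᶜ ≤ t) →
          (prodBernoulli w).real
              {ω : Set (Fin m) | (R.filter fun v => ω ∈ openDConn src tgt o v).card ≤ 1} ≤ t := by
  intro h
  have key := h 5 7 DirectedZeroOneCex.src DirectedZeroOneCex.tgt DirectedZeroOneCex.w DirectedZeroOneCex.relays 0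
    (3 / 16) DirectedZeroOneCex.relays_card DirectedZeroOneCex.two_lt_sum (fun v hv => DirectedZeroOneCex.compl_le hv)
  have low := DirectedZeroOneCex.lowerTail_ge
  unfold DirectedZeroOneCex.lowerTail at low
  linarith

end Summit.CriticalPhenomena.PercolationContinuityZ3.Theorems
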